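import Summits.QuantumFields.YangMills.Theorems.BalabanUVNodesN15DerivCoefficient
import HarnessLib

/-!
# Route «BalabanUVNodes» (cluster K4 «SpineRates»), Track-A DAG node N15 = NE2, BACKGROUND LAYER — THE GENERATOR-LEVEL DATA OF THE CURVED KNIT ON `ℤ^d` AT THE LINEARISED
# TRANSPORT: block-neighbour compatibility of `⌊·∕M⌋`, and the VECTOR-VALUED species-S0∕S2 fits (plain fit `o`, lattice-derivative fit `o_D`) of an `𝔄`-valued generator field
# against its block mean, from (3.35)∕(3.36)-SHAPED per-bond letters — n15-b 12a∕12b's real-scalar theorems transferred through the dual-norm characterisation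

Cell `pub-ymgap`, seat `pub-ymgap-dag-n15-w3` (WIDTH SEAT 3∕3 on node N15, director-ym №197 ∕ HUMAN RULING D-0149; plan `W-SEAT-START-LIST.md` §n15 item 3 — eighth piece).
`bears_on: R4∕N15 · K3⁷ SpineGivenEndpointR13SepCoPH (stmt-QuantumFields-20544)`.  Filed `--kind proof --supports stmt-QuantumFields-20544 --as helper` — COUNT-NEUTRAL.  Imports BY
NAME dag-n15-b 12b `…N15DerivCoefficient` (`coord_bounds_of_blockMap`, `ediv_mem_of_bounds_two`, `slab`, `fit_fdiffN_blockMean`; through it 12a `…N15BlockMean`: `blockMean`,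
`offs`, `bpt`, `fit_blockMean`, `blockMean_sub`, `blockMean_const_mul`, and [Lit] `T4EtaRateCoeffDefect.InBlockBondBound`) and this seat's file 7 `…N15CurvedDressedPairDefectExp`
(`fitTranslated_of_fit_of_compat`); nothing in the tree is modified.

WHY.  File 7's knit `hasMaj_idef_curvDressed_exp` displays GENERATOR-LEVEL data on abstract carriers: the plain fit `‖Z′(x′) − Z(πx′)‖ ≤ o`, the translated fits `o_t`, `o_W`
(reduced to plain fits + gradient letters by `fitTranslated_of_fit_of_compat` under the block-neighbour compatibility of `(π, τ, τ′)`), and the lattice-derivative fit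
`‖η′⁻¹(Z′₊ − Z′₋) − η⁻¹(Z₊ − Z₋)‖ ≤ o_D`.  On the lineage's concrete pairing — `ℤ^d`, blocks of side `M`, `π = ⌊·∕M⌋` (`blockMap`), unit translations, `Mη′ = η`, the coarse
generator the BLOCK MEAN of the fine one (the LINEARISED transport; n15-b 12a) — these are theorems from per-bond letters of the (3.35)∕(3.36) shape
([Balaban1985BackgroundPropagators] (3.35) p. 396 *«|A| < O(1)Mα₀(L^jη)^{−1}, |∇^ηA| < O(1)Mα₀(L^jη)^{−2}»*, (3.36) *«|∂^{η*}∂^ηA| < O(1)Mα₀(L^jη)^{−3}»*): 12a `fit_blockMean` (S0)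
and 12b `fit_fdiffN_blockMean` (S2) for REAL fields.  THIS FILE transfers them to fields with values in any real normed space `V` (the knit's `𝔄 →L[ℝ] 𝔄`) by scalarisation
through continuous functionals and `NormedSpace.norm_le_dual_bound`, and proves the compatibility:

* §1 ★ `blockMap_sub_single_compat` (`⌊(x − e_μ)∕M⌋ ∈ {⌊x∕M⌋, ⌊x∕M⌋ − e_μ}`, `M ≥ 1`), `blockMap_compat_addRight` — file 7's `hcompat` on `ℤ^d` for the unit translations;
* §2 def `blockMeanV` (the `V`-valued block mean in 12a's `offs`∕`bpt` format; 13c's `blockAvgV` is the abstract-fibre cousin), `apply_blockMeanV` (`φ ∘ blockMeanV = blockMean (φ ∘ ·)` for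
  `φ : V →L[ℝ] ℝ`), `inBlockBondBound_comp`, ★★ `fit_blockMeanV` (S0, vector-valued: `‖a′(x′) − blockMeanV a′(⌊x′∕M⌋)‖ ≤ d(M−1)·θ₁(⌊x′∕M⌋)` from the (3.35)-shaped per-bond letter
  inside blocks), `fit_blockMeanV_rate` (`θ₁ = η′G₁`, `Mη′ = η` ⟹ `≤ d·η·G₁`: RATE ONE), `norm_blockMeanV_le` (sup letter: the coarse generator stays in the box `‖·‖ ≤ r`);
* §3 `fdiffN_comp_apply`, `bdiffN_comp_apply`, ★★ `fit_fdiffV_blockMeanV` (S2, forward quotients) and ★★ `fit_bdiffV_blockMeanV` (S2 in THE KNIT's backward orientation: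
  `‖η′⁻¹(a′(x′) − a′(x′ − e_μ)) − η⁻¹(ā(y) − ā(y − e_μ))‖ ≤ (d+1)(M−1)·θ₂(y − e_μ)`, `y = ⌊x′∕M⌋`, from the (3.36)-shaped vector letter on the slab), `fit_bdiffV_blockMeanV_rate`
  (`θ₂ = η′G₂` ⟹ `≤ (d+1)·η·G₂` = file 7's `o_D`, RATE ONE), `norm_fdiffV_blockMeanV_le` ((R3) linearised: the coarse gradient letter of the block mean IS the fine one).
So on the lineage's `ℤ^d` pairing every generator-level datum of file 7 (`o` by §2, `o_D` by §3, `o_t`∕`o_W` by file 7 §1 + `blockMap_compat_addRight`, the coarse sizes and gradient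
letters by `norm_blockMeanV_le`∕`norm_fdiffV_blockMeanV_le`) is a theorem from (3.35)∕(3.36)-SHAPED per-bond letters on the FINE generator fields.

HONEST FRAMING ∕ LIMITS.  Linear algebra + 12a∕12b by name; the transport is the LINEARISED one (block mean of the generator) — Bałaban's (C3) transport is the nonlinear `n`-fold
average, whose fit letter is NE3's currency (n15-b memo); flat differences on `ℤ^d`; crude constants; nothing of [B9] asserted ((3.35)–(3.37) p. 396 = SHAPES).  NE2⁺ NOT PRINTED, NOT
proved; N15 NOT discharged; counts of record UNMOVED (typed 28∕28 · discharged 5∕27); one finite 𝕋⁴ at fixed ε — NOT infinite volume, NOT OS on ℝ⁴, NOT a mass gap, NOT Clay; R4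
closes the conditional finite-𝕋⁴ rung `BalabanLadder.UV` only.  Restate-immune (no Theses import).
-/

set_option autoImplicit false

noncomputable section
open scoped BigOperators
open Finset

namespace Summit.QuantumFields.YangMills.BalabanUVNodes.N15.CurvedSpecies

open Literature.MathematicalPhysics.QuantumFieldTheory.Balaban1983to89
open Literature.MathematicalPhysics.QuantumFieldTheory.Balaban1983to89.T4EtaRateCoeffDefect (InBlockBondBound coeff_osc_rate)
open Literature.MathematicalPhysics.QuantumLattice (blockMap)
open Literature.Probability.LatticeModels (Site)
open Summit.QuantumFields.YangMills.BalabanUVNodes.N15.DerivDefect (fdiffN fdiffN_apply bdiffN bdiffN_apply)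
open Summit.QuantumFields.YangMills.BalabanUVNodes.N15.CoefficientSpecies (offs bpt offs_nonempty blockMean abs_blockMean_le abs_fdiffN_blockMean_le fit_blockMean
  coord_bounds_of_blockMap ediv_mem_of_bounds_two slab fit_fdiffN_blockMean fit_bdiffN_blockMean species2_rate)

variable {d : ℕ}

/-! ## §1 Block-neighbour compatibility of `⌊·∕M⌋` with the unit translations -/

section Compat

/-- ★ ONE STEP BACK STAYS IN THE BLOCK OR ENTERS THE PRECEDING BLOCK: `⌊(x − e_μ)∕M⌋ = ⌊x∕M⌋` or `= ⌊x∕M⌋ − e_μ` (`M ≥ 1`) — file 7's `hcompat` for `π = blockMap M` and the unit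
translations on both grids. [folklore] -/
theorem blockMap_sub_single_compat {M : ℕ} (hM : 0 < M) (x : Site d) (μ : Fin d) :
    blockMap M (x - Pi.single μ 1) = blockMap M x ∨ blockMap M (x - Pi.single μ 1) = blockMap M x - Pi.single μ 1 := by
  have hb := coord_bounds_of_blockMap hM x μ
  have hother : ∀ i, i ≠ μ → blockMap M (x - Pi.single μ 1) i = blockMap M x i := fun i hi => by
    simp only [blockMap, Pi.sub_apply, Pi.single_eq_of_ne hi, sub_zero]
  have hμ : blockMap M (x - Pi.single μ 1) μ = blockMap M x μ - 1 ∨ blockMap M (x - Pi.single μ 1) μ = blockMap M x μ - 1 + 1 := by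
    have h := ediv_mem_of_bounds_two hM (s := x μ - 1) (c := blockMap M x μ - 1) (by linarith [hb.1]) (by linarith [hb.2])
    simpa only [blockMap, Pi.sub_apply, Pi.single_eq_same] using h
  rcases hμ with h | h
  · right
    funext i
    by_cases hi : i = μ
    · subst hi; rw [Pi.sub_apply, Pi.single_eq_same, h]
    · rw [Pi.sub_apply, Pi.single_eq_of_ne hi, sub_zero, hother i hi]
  · left
    funext i
    by_cases hi : i = μ
    · subst hi; rw [h, sub_add_cancel]
    · exact hother i hi

/-- The same in file 7's `hcompat` shape for the unit translations `Equiv.addRight e_μ` on both grids. [folklore] -/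
theorem blockMap_compat_addRight {M : ℕ} (hM : 0 < M) (μ : Fin d) (x' : Site d) :
    blockMap M ((Equiv.addRight (Pi.single μ (1 : ℤ))).symm x') = blockMap M x' ∨
      blockMap M ((Equiv.addRight (Pi.single μ (1 : ℤ))).symm x') = (Equiv.addRight (Pi.single μ (1 : ℤ))).symm (blockMap M x') := by
  simp only [Equiv.addRight_symm, Equiv.coe_addRight, ← sub_eq_add_neg]
  exact blockMap_sub_single_compat hM x' μ

end Compat

/-! ## §2 The vector-valued block mean and the species-S0 fit by scalarisation -/

section BlockMeanV

variable {V : Type} [NormedAddCommGroup V] [NormedSpace ℝ V]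

/-- THE `V`-VALUED BLOCK MEAN over the block of side `M` labelled by a coarse site (12a `blockMean` for vector values: the LINEARISED transport of a `𝔤`-valued generator).
[folklore] -/
def blockMeanV (M : ℕ) (a' : Site d → V) (y : Site d) : V := ((M : ℝ) ^ d)⁻¹ • ∑ t ∈ offs d M, a' (bpt M y t)

/-- SCALARISATION: a continuous functional of the vector block mean is the block mean of the scalarised field. [folklore] -/
theorem apply_blockMeanV (φ : V →L[ℝ] ℝ) (M : ℕ) (a' : Site d → V) (y : Site d) : φ (blockMeanV M a' y) = blockMean M (fun x => φ (a' x)) y := by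
  rw [blockMeanV, map_smul, map_sum, blockMean, smul_eq_mul, div_eq_inv_mul]

/-- A VECTOR per-bond letter gives the scalar one for every scalarisation, with `‖φ‖·θ`. [folklore] -/
theorem inBlockBondBound_comp (φ : V →L[ℝ] ℝ) {M : ℕ} {a' : Site d → V} {θ : Site d → ℝ}
    (h : ∀ (x : Site d) (μ : Fin d), blockMap M (x + Pi.single μ 1) = blockMap M x → ‖a' (x + Pi.single μ 1) - a' x‖ ≤ θ (blockMap M x)) :
    InBlockBondBound M (fun x => φ (a' x)) (fun y => ‖φ‖ * θ y) := by
  intro x μ hx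
  rw [← map_sub, ← Real.norm_eq_abs]
  exact (φ.le_opNorm _).trans (mul_le_mul_of_nonneg_left (h x μ hx) (norm_nonneg _))

/-- ★★ **SPECIES S0, VECTOR-VALUED** (file 7's plain fit `o` at the linearised transport): from the (3.35)-SHAPED per-bond letter inside blocks `‖a′(x + e_μ) − a′(x)‖ ≤ θ₁(⌊x∕M⌋)`
(`θ₁ ≥ 0`), `‖a′(x′) − blockMeanV a′(⌊x′∕M⌋)‖ ≤ d(M−1)·θ₁(⌊x′∕M⌋)` — 12a `fit_blockMean` for every scalarisation, then `NormedSpace.norm_le_dual_bound`.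
[cite: Balaban1985BackgroundPropagators, (3.35) p.396 (shape)] -/
theorem fit_blockMeanV {M : ℕ} (hM : 0 < M) {a' : Site d → V} {θ₁ : Site d → ℝ} (hθ : ∀ y, 0 ≤ θ₁ y)
    (h : ∀ (x : Site d) (μ : Fin d), blockMap M (x + Pi.single μ 1) = blockMap M x → ‖a' (x + Pi.single μ 1) - a' x‖ ≤ θ₁ (blockMap M x)) (x' : Site d) :
    ‖a' x' - blockMeanV M a' (blockMap M x')‖ ≤ (d : ℝ) * ((M : ℝ) - 1) * θ₁ (blockMap M x') := by
  have hM1 : (0 : ℝ) ≤ (M : ℝ) - 1 := by have h1 : (1 : ℝ) ≤ M := (by exact_mod_cast hM); linarith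
  have hC : 0 ≤ (d : ℝ) * ((M : ℝ) - 1) * θ₁ (blockMap M x') := mul_nonneg (mul_nonneg (Nat.cast_nonneg _) hM1) (hθ _)
  refine NormedSpace.norm_le_dual_bound ℝ _ hC fun φ => ?_
  have hs := fit_blockMean hM (a' := fun x => φ (a' x)) (θ₁ := fun y => ‖φ‖ * θ₁ y) (fun y => mul_nonneg (norm_nonneg _) (hθ y)) (inBlockBondBound_comp φ h) x'
  rw [← apply_blockMeanV, ← map_sub] at hs
  calc ‖φ (a' x' - blockMeanV M a' (blockMap M x'))‖ = |φ (a' x' - blockMeanV M a' (blockMap M x'))| := Real.norm_eq_abs _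
    _ ≤ (d : ℝ) * ((M : ℝ) - 1) * (‖φ‖ * θ₁ (blockMap M x')) := hs
    _ = (d : ℝ) * ((M : ℝ) - 1) * θ₁ (blockMap M x') * ‖φ‖ := by ring

/-- SUP LETTER, VECTOR-VALUED ((R3) linearised, 12a `abs_blockMean_le`): `‖a′‖ ≤ r` on the block ⟹ `‖blockMeanV a′(y)‖ ≤ r` (`M ≥ 1`) — the coarse generator stays in the box
of the species letters. [folklore] -/
theorem norm_blockMeanV_le {M : ℕ} (hM : 0 < M) {a' : Site d → V} {y : Site d} {r : ℝ} (h : ∀ t ∈ offs d M, ‖a' (bpt M y t)‖ ≤ r) :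
    ‖blockMeanV M a' y‖ ≤ r := by
  obtain ⟨t₀, ht₀⟩ := offs_nonempty (d := d) hM
  have hr : 0 ≤ r := (norm_nonneg _).trans (h t₀ ht₀)
  refine NormedSpace.norm_le_dual_bound ℝ _ hr fun φ => ?_
  have hs := abs_blockMean_le hM (a' := fun x => φ (a' x)) (y := y) (C := ‖φ‖ * r) fun t ht => by
    rw [← Real.norm_eq_abs]; exact (φ.le_opNorm _).trans (mul_le_mul_of_nonneg_left (h t ht) (norm_nonneg _))
  rw [← apply_blockMeanV] at hs
  rw [Real.norm_eq_abs, mul_comm]; exact hs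

/-- RATE of S0 (12a `fit_blockMean_rate` shape): with the (3.35)-shaped letter `θ₁ = η′G₁` and `Mη′ = η`, `‖a′(x′) − blockMeanV a′(⌊x′∕M⌋)‖ ≤ d·η·G₁` — RATE ONE in `η`.
[cite: Balaban1985BackgroundPropagators, (3.35) p.396 (shape)] -/
theorem fit_blockMeanV_rate {M : ℕ} (hM : 0 < M) {η η' G₁ : ℝ} (hη' : 0 ≤ η') (hG₁ : 0 ≤ G₁) (hMη : (M : ℝ) * η' = η) {a' : Site d → V}
    (h : ∀ (x : Site d) (μ : Fin d), blockMap M (x + Pi.single μ 1) = blockMap M x → ‖a' (x + Pi.single μ 1) - a' x‖ ≤ η' * G₁) (x' : Site d) :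
    ‖a' x' - blockMeanV M a' (blockMap M x')‖ ≤ (d : ℝ) * η * G₁ :=
  (fit_blockMeanV hM (θ₁ := fun _ => η' * G₁) (fun _ => mul_nonneg hη' hG₁) h x').trans (coeff_osc_rate d M hη' hG₁ rfl hMη)

end BlockMeanV

/-! ## §3 The species-S2 fit (lattice derivatives), vector-valued -/

section DerivV

variable {V : Type} [NormedAddCommGroup V] [NormedSpace ℝ V]

/-- The forward quotient of the scalarised field is the scalarisation of the vector forward quotient. [folklore] -/
theorem fdiffN_comp_apply (φ : V →L[ℝ] ℝ) (η : ℝ) (μ : Fin d) (a : Site d → V) (x : Site d) :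
    fdiffN η (fun w => w + Pi.single μ 1) (fun w => φ (a w)) x = φ (η⁻¹ • (a (x + Pi.single μ 1) - a x)) := by
  rw [fdiffN_apply, map_smul, map_sub, smul_eq_mul]

/-- ★★ **SPECIES S2, VECTOR-VALUED, FORWARD QUOTIENTS** (file 7's lattice-derivative fit `o_D` at the linearised transport, `Mη′ = η`): from the (3.36)-SHAPED vector letter on
the slab `block(y) ∪ block(y + e_μ)` — the unit differences of the FINE DERIVATIVE `η′⁻¹(a′(z + e_μ) − a′(z))` are `≤ θ₂(y)` there (`θ₂ ≥ 0`) —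
`‖η′⁻¹(a′(x′ + e_μ) − a′(x′)) − η⁻¹(blockMeanV a′(y + e_μ) − blockMeanV a′(y))‖ ≤ (d+1)(M−1)·θ₂(y)`, `y = ⌊x′∕M⌋` (12b `fit_fdiffN_blockMean` scalarised).
[cite: Balaban1985BackgroundPropagators, (3.36) p.396 (shape)] -/
theorem fit_fdiffV_blockMeanV {M : ℕ} (hM : 0 < M) (μ : Fin d) {η η' : ℝ} (hMη : (M : ℝ) * η' = η) {a' : Site d → V} {θ₂ : Site d → ℝ} (hθ : ∀ y, 0 ≤ θ₂ y)
    (hstep : ∀ y, ∀ z ∈ slab M y μ, ∀ ν : Fin d,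
      ‖η'⁻¹ • (a' (z + Pi.single ν 1 + Pi.single μ 1) - a' (z + Pi.single ν 1)) - η'⁻¹ • (a' (z + Pi.single μ 1) - a' z)‖ ≤ θ₂ y)
    (x' : Site d) :
    ‖η'⁻¹ • (a' (x' + Pi.single μ 1) - a' x') -
        η⁻¹ • (blockMeanV M a' (blockMap M x' + Pi.single μ 1) - blockMeanV M a' (blockMap M x'))‖ ≤
      ((d : ℝ) + 1) * ((M : ℝ) - 1) * θ₂ (blockMap M x') := by
  have hM1 : (0 : ℝ) ≤ (M : ℝ) - 1 := by have h1 : (1 : ℝ) ≤ M := (by exact_mod_cast hM); linarith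
  have hC : 0 ≤ ((d : ℝ) + 1) * ((M : ℝ) - 1) * θ₂ (blockMap M x') := mul_nonneg (mul_nonneg (by positivity) hM1) (hθ _)
  refine NormedSpace.norm_le_dual_bound ℝ _ hC fun φ => ?_
  have hstep' : ∀ y, ∀ z ∈ slab M y μ, ∀ ν : Fin d,
      |fdiffN η' (fun w => w + Pi.single μ 1) (fun w => φ (a' w)) (z + Pi.single ν 1) - fdiffN η' (fun w => w + Pi.single μ 1) (fun w => φ (a' w)) z| ≤
        ‖φ‖ * θ₂ y := fun y z hz ν => by
    rw [fdiffN_comp_apply, fdiffN_comp_apply, ← map_sub, ← Real.norm_eq_abs]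
    exact (φ.le_opNorm _).trans (mul_le_mul_of_nonneg_left (hstep y z hz ν) (norm_nonneg _))
  have hs := fit_fdiffN_blockMean hM μ hMη (a' := fun w => φ (a' w)) (θ₂ := fun y => ‖φ‖ * θ₂ y) hstep' x'
  have hcoarse : fdiffN η (fun w => w + Pi.single μ 1) (blockMean M fun w => φ (a' w)) (blockMap M x') =
      φ (η⁻¹ • (blockMeanV M a' (blockMap M x' + Pi.single μ 1) - blockMeanV M a' (blockMap M x'))) := by
    rw [fdiffN_apply, map_smul, map_sub, apply_blockMeanV, apply_blockMeanV, smul_eq_mul]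
  rw [fdiffN_comp_apply, hcoarse, ← map_sub] at hs
  calc _ = |φ (η'⁻¹ • (a' (x' + Pi.single μ 1) - a' x') - η⁻¹ • (blockMeanV M a' (blockMap M x' + Pi.single μ 1) - blockMeanV M a' (blockMap M x')))| :=
        Real.norm_eq_abs _
    _ ≤ ((d : ℝ) + 1) * ((M : ℝ) - 1) * (‖φ‖ * θ₂ (blockMap M x')) := hs
    _ = ((d : ℝ) + 1) * ((M : ℝ) - 1) * θ₂ (blockMap M x') * ‖φ‖ := by ring

/-- The adjoint quotient of the scalarised field is the scalarisation of the vector backward quotient `η⁻¹(a(x − e_μ) − a(x))`. [folklore] -/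
theorem bdiffN_comp_apply (φ : V →L[ℝ] ℝ) (η : ℝ) (μ : Fin d) (a : Site d → V) (x : Site d) :
    bdiffN η (Equiv.addRight (Pi.single μ (1 : ℤ))) (fun w => φ (a w)) x = φ (η⁻¹ • (a (x - Pi.single μ 1) - a x)) := by
  simp only [bdiffN_apply, Equiv.addRight_symm, Equiv.coe_addRight, ← sub_eq_add_neg, map_smul, map_sub, smul_eq_mul]

/-- ★★ **SPECIES S2, VECTOR-VALUED, BACKWARD QUOTIENTS — THE KNIT's ORIENTATION** (file 7's `hfitD` with `(τ_μ)⁻¹x = x − e_μ`): from the same slab letter located at `y − e_μ`,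
`‖η′⁻¹(a′(x′) − a′(x′ − e_μ)) − η⁻¹(blockMeanV a′(y) − blockMeanV a′(y − e_μ))‖ ≤ (d+1)(M−1)·θ₂(y − e_μ)`, `y = ⌊x′∕M⌋` (12b `fit_bdiffN_blockMean` scalarised; the adjoint
quotient is minus this backward quotient, norms agree). [cite: Balaban1985BackgroundPropagators, (3.36) p.396 (shape)] -/
theorem fit_bdiffV_blockMeanV {M : ℕ} (hM : 0 < M) (μ : Fin d) {η η' : ℝ} (hMη : (M : ℝ) * η' = η) {a' : Site d → V} {θ₂ : Site d → ℝ} (hθ : ∀ y, 0 ≤ θ₂ y)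
    (hstep : ∀ y, ∀ z ∈ slab M y μ, ∀ ν : Fin d,
      ‖η'⁻¹ • (a' (z + Pi.single ν 1 + Pi.single μ 1) - a' (z + Pi.single ν 1)) - η'⁻¹ • (a' (z + Pi.single μ 1) - a' z)‖ ≤ θ₂ y)
    (x' : Site d) :
    ‖η'⁻¹ • (a' x' - a' (x' - Pi.single μ 1)) -
        η⁻¹ • (blockMeanV M a' (blockMap M x') - blockMeanV M a' (blockMap M x' - Pi.single μ 1))‖ ≤
      ((d : ℝ) + 1) * ((M : ℝ) - 1) * θ₂ (blockMap M x' - Pi.single μ 1) := by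
  have hM1 : (0 : ℝ) ≤ (M : ℝ) - 1 := by have h1 : (1 : ℝ) ≤ M := (by exact_mod_cast hM); linarith
  have hC : 0 ≤ ((d : ℝ) + 1) * ((M : ℝ) - 1) * θ₂ (blockMap M x' - Pi.single μ 1) := mul_nonneg (mul_nonneg (by positivity) hM1) (hθ _)
  -- the knit's orientation is minus 12b's adjoint orientation
  have hflip : η'⁻¹ • (a' x' - a' (x' - Pi.single μ 1)) - η⁻¹ • (blockMeanV M a' (blockMap M x') - blockMeanV M a' (blockMap M x' - Pi.single μ 1)) =
      -(η'⁻¹ • (a' (x' - Pi.single μ 1) - a' x') - η⁻¹ • (blockMeanV M a' (blockMap M x' - Pi.single μ 1) - blockMeanV M a' (blockMap M x'))) := by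
    simp only [smul_sub]; abel
  rw [hflip, norm_neg]
  refine NormedSpace.norm_le_dual_bound ℝ _ hC fun φ => ?_
  have hstep' : ∀ y, ∀ z ∈ slab M y μ, ∀ ν : Fin d,
      |fdiffN η' (fun w => w + Pi.single μ 1) (fun w => φ (a' w)) (z + Pi.single ν 1) - fdiffN η' (fun w => w + Pi.single μ 1) (fun w => φ (a' w)) z| ≤
        ‖φ‖ * θ₂ y := fun y z hz ν => by
    rw [fdiffN_comp_apply, fdiffN_comp_apply, ← map_sub, ← Real.norm_eq_abs]
    exact (φ.le_opNorm _).trans (mul_le_mul_of_nonneg_left (hstep y z hz ν) (norm_nonneg _))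
  have hs := fit_bdiffN_blockMean hM μ hMη (a' := fun w => φ (a' w)) (θ₂ := fun y => ‖φ‖ * θ₂ y) hstep' x'
  have hcoarse : bdiffN η (Equiv.addRight (Pi.single μ (1 : ℤ))) (blockMean M fun w => φ (a' w)) (blockMap M x') =
      φ (η⁻¹ • (blockMeanV M a' (blockMap M x' - Pi.single μ 1) - blockMeanV M a' (blockMap M x'))) := by
    simp only [bdiffN_apply, Equiv.addRight_symm, Equiv.coe_addRight, ← sub_eq_add_neg, map_smul, map_sub, apply_blockMeanV, smul_eq_mul]
  rw [bdiffN_comp_apply, hcoarse, ← map_sub] at hs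
  calc _ = |φ (η'⁻¹ • (a' (x' - Pi.single μ 1) - a' x') - η⁻¹ • (blockMeanV M a' (blockMap M x' - Pi.single μ 1) - blockMeanV M a' (blockMap M x')))| :=
        Real.norm_eq_abs _
    _ ≤ ((d : ℝ) + 1) * ((M : ℝ) - 1) * (‖φ‖ * θ₂ (blockMap M x' - Pi.single μ 1)) := hs
    _ = ((d : ℝ) + 1) * ((M : ℝ) - 1) * θ₂ (blockMap M x' - Pi.single μ 1) * ‖φ‖ := by ring

/-- RATE of S2 (12b `species2_rate`): with the (3.36)-shaped letter `θ₂ = η′G₂` and `Mη′ = η`, the backward-quotient fit is `≤ (d+1)·η·G₂` — RATE ONE in `η` (file 7's `o_D`).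
[cite: Balaban1985BackgroundPropagators, (3.36) p.396 (shape)] -/
theorem fit_bdiffV_blockMeanV_rate {M : ℕ} (hM : 0 < M) (μ : Fin d) {η η' G₂ : ℝ} (hη' : 0 ≤ η') (hG₂ : 0 ≤ G₂) (hMη : (M : ℝ) * η' = η) {a' : Site d → V}
    (hstep : ∀ y, ∀ z ∈ slab M y μ, ∀ ν : Fin d,
      ‖η'⁻¹ • (a' (z + Pi.single ν 1 + Pi.single μ 1) - a' (z + Pi.single ν 1)) - η'⁻¹ • (a' (z + Pi.single μ 1) - a' z)‖ ≤ η' * G₂) (x' : Site d) :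
    ‖η'⁻¹ • (a' x' - a' (x' - Pi.single μ 1)) -
        η⁻¹ • (blockMeanV M a' (blockMap M x') - blockMeanV M a' (blockMap M x' - Pi.single μ 1))‖ ≤ ((d : ℝ) + 1) * η * G₂ :=
  (fit_bdiffV_blockMeanV hM μ hMη (θ₂ := fun _ => η' * G₂) (fun _ => mul_nonneg hη' hG₂) hstep x').trans (species2_rate d M hη' hG₂ hMη)

/-- GRADIENT LETTER OF THE BLOCK MEAN, VECTOR-VALUED ((R3) linearised, 12a `abs_fdiffN_blockMean_le`): a bound `G` on the fine quotients `η′⁻¹(a′(w + e_μ) − a′(w))` on the window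
`{M·y + t + k e_μ}` gives the SAME bound on the coarse quotient `η⁻¹(blockMeanV a′(y + e_μ) − blockMeanV a′(y))` (`Mη′ = η`) — the knit's coarse gradient letter `ηg` from the fine one.
[cite: Balaban1985BackgroundPropagators, (3.35) p.396 (shape)] -/
theorem norm_fdiffV_blockMeanV_le {M : ℕ} (hM : 0 < M) {η η' : ℝ} (hMη : (M : ℝ) * η' = η) {a' : Site d → V} (μ : Fin d) {y : Site d} {G : ℝ}
    (h : ∀ t ∈ offs d M, ∀ k < M, ‖η'⁻¹ • (a' (bpt M y t + Pi.single μ (k : ℤ) + Pi.single μ 1) - a' (bpt M y t + Pi.single μ (k : ℤ)))‖ ≤ G) :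
    ‖η⁻¹ • (blockMeanV M a' (y + Pi.single μ 1) - blockMeanV M a' y)‖ ≤ G := by
  obtain ⟨t₀, ht₀⟩ := offs_nonempty (d := d) hM
  have hG : 0 ≤ G := (norm_nonneg _).trans (h t₀ ht₀ 0 hM)
  refine NormedSpace.norm_le_dual_bound ℝ _ hG fun φ => ?_
  have hs := abs_fdiffN_blockMean_le hM hMη (a' := fun w => φ (a' w)) μ (y := y) (G := ‖φ‖ * G) fun t ht k hk => by
    rw [fdiffN_comp_apply, ← Real.norm_eq_abs]; exact (φ.le_opNorm _).trans (mul_le_mul_of_nonneg_left (h t ht k hk) (norm_nonneg _))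
  have hcoarse : fdiffN η (fun w => w + Pi.single μ 1) (blockMean M fun w => φ (a' w)) y = φ (η⁻¹ • (blockMeanV M a' (y + Pi.single μ 1) - blockMeanV M a' y)) := by
    rw [fdiffN_apply, map_smul, map_sub, apply_blockMeanV, apply_blockMeanV, smul_eq_mul]
  rw [hcoarse] at hs
  rw [Real.norm_eq_abs, mul_comm]; exact hs

end DerivV

end Summit.QuantumFields.YangMills.BalabanUVNodes.N15.CurvedSpecies

end
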